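import Literature.NumberTheory.GelbartRogawski1991.DoubledWeilRepresentationUndoubling
import Literature.NumberTheory.GelbartRogawski1991.DoubledWeilRepresentationFiniteHalf
import Literature.NumberTheory.Automorphic.AdelicSchwartzBruhatDirectSumPure
import HarnessLib

-- buildfix G11b-3 recipe (LEDGER B13-1/B13-3): elaborate sequentially so the trailing `attribute [implicit_reducible]`
-- block (reducibilityCoreExt is keyed to the async environment branch) is in force at `.olean` export.
set_option Elab.async false

/-!
# Undoubling through `undoubleIdx`: the doubled Weil operator on pure tensors, read back on `Fin (n + n)`

[GelbartRogawski1991, §3.1 Prop. 3.1.1] by doubling [Kudla1994, §2], vector-level bookkeeping for the undoubled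
splitting of `DoubledWeilRepresentationUndoubling`.  Recall `u(g) := undoubleIdx (sD (g ⊕ 1))`
(`uD`), `undoubleIdx = relabel_{C = 1} ∘ reindex_{e₂⁻¹}` (`Fin (n + n) → Fin n ⊕ Fin n`), and the product formula
`ω(u(g))(Φ₁ ⊠ Φ₂) = ω(s(g))Φ₁ ⊠ Φ₂` pinning `s(g) := undouble sD g` (`omega_uD_tensorToSum`).  This file records:

* §1 `omega_uD_apply`: `ω_{T ⊕ (−T)}(u(g)) Ψ = R_{e₂⁻¹} (ω_{T^𝔻}(sD (g ⊕ 1)) (R_{e₂} Ψ))` for ANY `sD` — the relabelling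
  does not move the operator (`adelicMpCont.omega_relabel`) and the reindexing conjugates it by the coordinate change
  `R_e Φ = Φ ∘ (· ∘ e)` (`adelicMpCont.omega_reindex_apply`);
* §2 `piSBReindex_tensorToSum_tmul`: `R_ε ((a₁ ⊗ f₁) ⊠ (a₂ ⊗ f₂)) = R_ε^∞ (a₁ ⊠_∞ a₂) ⊗ R_ε^f (f₁ ⊠_f f₂)` on pure
  tensors (`tensorToSum_tmul` + `piSBReindex_tmul`), the `⊠ Φ₂`-cancellation `tensorToSum_left_cancel`,
  `finBox_eq_of_piProdSB` (a finite identity linear in `f₁` holds for all `f₁` once it holds on place-pure tensors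
  `⊗_v φ_v`, `span_range_piProdSB`) and `piSchwartzBruhatEquiv_tmul_ne_zero` (`a ⊗ f ≠ 0` for `a, f ≠ 0`);
* §3 `omega_uD_tensorToSum_tmul`: if `sD (g ⊕ 1)` acts by a FINITE operator `1 ⊗ B` (as every finite half does,
  `IsFinHalf.isFinite`; in particular `sD (g ⊕ 1) = s_f(h)` for the finite half `s_f = finHalf χ 𝔪 𝓕`, where
  `B = Ω^𝔻(h)`, `omega_uD_tensorToSum_tmul_of_eq_finHalf`), then
  `ω(u(g))((a₁ ⊗ f₁) ⊠ (a₂ ⊗ f₂)) = R_{e₂⁻¹} (R_{e₂}^∞ (a₁ ⊠_∞ a₂) ⊗ B (R_{e₂}^f (f₁ ⊠_f f₂)))`;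
* §4 the fold-back `omega_uD_tensorToSum_tmul_eq_tensorToSum`: if moreover `B (R_{e₂}^f (f₁ ⊠_f f₂)) = R_{e₂}^f (f₁′ ⊠_f f₂′)`
  then `ω(u(g))((a₁ ⊗ f₁) ⊠ (a₂ ⊗ f₂)) = (a₁ ⊗ f₁′) ⊠ (a₂ ⊗ f₂′)`, and the read-back on the undoubled splitting
  `omega_undouble_tmul`: `ω(s(g))(a₁ ⊗ f₁) = a₁ ⊗ f₁′` when `f₂′ = f₂` and `a₂ ⊗ f₂ ≠ 0` (product formula + cancellation);
  `omega_undouble_eq_adelicTensorEnd`: if this holds for all `a₁, f₁` with `f₁′ = B₁ f₁` then `ω(s(g)) = 1 ⊗ B₁`;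
* §5 `undouble_eq_of_proj_eq_of_omega_eq` (`(π, ω)` jointly injective on `Mp(𝕎)ᶜᵒⁿᵗ`) and the identification
  `undouble_eq_of_omega_eq_adelicTensorEnd` (and `…_of_piProdSB`, finite identity on box vectors only): any
  `q ∈ Mp(𝕎)ᶜᵒⁿᵗ` over `ι(g)` with `ω(q) = 1 ⊗ B₁` IS `s(g)`.

Everything is sorry-free bookkeeping over tree names; no named fact, no new object.  What is NOT here: the finite
identity `Ω^𝔻(g ⊕ 1) (R_{e₂}^f (f₁ ⊠_f f₂)) = R_{e₂}^f (Ω(g) f₁ ⊠_f f₂)` (place by place, the local undoubling of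
`LocalUnitaryUndoubling`) and the matrix identity `(g ⊕ 1) = j_f(inl_f g_f)` for finite-adelic `g` — the two inputs
under which §4 identifies `s(g)` with the finite-adelic splitting of the undoubled family.
-/

set_option autoImplicit false

noncomputable section

open scoped Classical
open scoped Matrix Kronecker TensorProduct SchwartzMap
open NumberField NumberField.mixedEmbedding IsDedekindDomain
open Literature.RepresentationTheory.HeisenbergGroup
open Literature.NumberTheory.Automorphic
open Literature.NumberTheory.Weil1964
open Literature.RepresentationTheory.HarrisKudlaSweet1996
open Literature.NumberTheory.GaloisRepresentations

namespace Literature.NumberTheory.GelbartRogawski1991.GRConstruction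

open UnitaryDualPair
open Literature.NumberTheory.GelbartRogawski1991.UnitaryDualPair.LocalSplitting

/-! ## §2 (index-free part) `R_ε` on pure-tensor products and `⊠ Φ₂`-cancellation -/

section Reindex

variable (K : Type) [Field K] [NumberField K] {ι₁ ι₂ ι' : Type} [Fintype ι₁] [Fintype ι₂] [Fintype ι']

/-- **`R_ε` of a product of pure tensors**: `R_ε ((a₁ ⊗ f₁) ⊠ (a₂ ⊗ f₂)) = R_ε^∞ (a₁ ⊠_∞ a₂) ⊗ R_ε^f (f₁ ⊠_f f₂)`
along `ε : ι₁ ⊕ ι₂ ≃ ι′` (`tensorToSum_tmul` + `piSBReindex_tmul`). [cite: Weil1964, n° 29 (standard functions are sums of products of local ones), Chap. III n° 37–38 pp. 188–190] -/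
theorem piSBReindex_tensorToSum_tmul (ε : ι₁ ⊕ ι₂ ≃ ι')
    (a₁ : 𝓢((ι₁ → mixedSpace K), ℂ)) (f₁ : FinSB K ι₁) (a₂ : 𝓢((ι₂ → mixedSpace K), ℂ)) (f₂ : FinSB K ι₂) :
    piSBReindex K ε (tensorToSum K ι₁ ι₂ (piSchwartzBruhatEquiv K ι₁ (a₁ ⊗ₜ f₁)) (piSchwartzBruhatEquiv K ι₂ (a₂ ⊗ₜ f₂))) =
      piSchwartzBruhatEquiv K ι'
        (schwartzReindexCLM K ε (archBoxTensor a₁ a₂) ⊗ₜ finSBReindex K ε (finSumEquiv K ι₁ ι₂ (f₁ ⊗ₜ f₂))) := by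
  rw [tensorToSum_tmul, piSBReindex_tmul]

/-- the same read backwards: `R_ε⁻¹ (R_ε^∞ (a₁ ⊠_∞ a₂) ⊗ R_ε^f (f₁ ⊠_f f₂)) = (a₁ ⊗ f₁) ⊠ (a₂ ⊗ f₂)`. [cite: Weil1964, n° 29 (standard functions are sums of products of local ones), Chap. III n° 37–38 pp. 188–190] -/
theorem piSBReindex_symm_tmul_eq_tensorToSum (ε : ι₁ ⊕ ι₂ ≃ ι')
    (a₁ : 𝓢((ι₁ → mixedSpace K), ℂ)) (f₁ : FinSB K ι₁) (a₂ : 𝓢((ι₂ → mixedSpace K), ℂ)) (f₂ : FinSB K ι₂) :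
    piSBReindex K ε.symm (piSchwartzBruhatEquiv K ι'
        (schwartzReindexCLM K ε (archBoxTensor a₁ a₂) ⊗ₜ finSBReindex K ε (finSumEquiv K ι₁ ι₂ (f₁ ⊗ₜ f₂)))) =
      tensorToSum K ι₁ ι₂ (piSchwartzBruhatEquiv K ι₁ (a₁ ⊗ₜ f₁)) (piSchwartzBruhatEquiv K ι₂ (a₂ ⊗ₜ f₂)) := by
  rw [← piSBReindex_tensorToSum_tmul, piSBReindex_symm_apply_apply']

variable {K} in
/-- **`⊠ Φ₂`-cancellation**: `Ψ ⊠ Φ₂ = Ψ′ ⊠ Φ₂` with `Φ₂ ≠ 0` forces `Ψ = Ψ′` (evaluate at `(x₁, x₂)` with `Φ₂(x₂) ≠ 0`).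
[cite: Weil1964, n° 29 (standard functions are sums of products of local ones), Chap. III n° 37–38 pp. 188–190] -/
theorem tensorToSum_left_cancel {Ψ Ψ' : piSchwartzBruhat K ι₁} {Φ₂ : piSchwartzBruhat K ι₂} (hΦ₂ : Φ₂ ≠ 0)
    (h : tensorToSum K ι₁ ι₂ Ψ Φ₂ = tensorToSum K ι₁ ι₂ Ψ' Φ₂) : Ψ = Ψ' := by
  -- adapted from the private lemma of the same name in `Weil1964/AdelicMetaplecticSumStripping`
  obtain ⟨x₂, hx₂⟩ : ∃ x₂, (Φ₂ : (ι₂ → AdeleRing (𝓞 K) K) → ℂ) x₂ ≠ 0 := by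
    by_contra hcon
    exact hΦ₂ (Subtype.ext (funext fun x => not_not.1 fun hx => hcon ⟨x, hx⟩))
  apply Subtype.ext
  funext x₁
  have h1 := congrArg (fun Ξ : piSchwartzBruhat K (ι₁ ⊕ ι₂) => (Ξ : (ι₁ ⊕ ι₂ → AdeleRing (𝓞 K) K) → ℂ) (Sum.elim x₁ x₂)) h
  simp only [coe_tensorToSum, boxTensor_elim] at h1
  exact mul_right_cancel₀ hx₂ h1

variable {K} in
omit [Fintype ι'] in
/-- **box vectors suffice**: an identity `B (R_ε^f (f₁ ⊠_f f₂)) = R_ε^f (B₁ f₁ ⊠_f f₂)`, linear in `f₁`, holds for every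
`f₁ ∈ 𝒮((𝔸_K^∞)^{ι₁})` as soon as it holds on the place-pure tensors `f₁ = ⊗_v φ_v` (`span_range_piProdSB`,
`LinearMap.ext_on_range`). [cite: Weil1964, n° 29 (standard functions are sums of products of local ones), Chap. III n° 37–38 pp. 188–190] -/
theorem finBox_eq_of_piProdSB (ε : ι₁ ⊕ ι₂ ≃ ι') {B : FinSB K ι' →ₗ[ℂ] FinSB K ι'} {B₁ : FinSB K ι₁ →ₗ[ℂ] FinSB K ι₁}
    {f₂ : FinSB K ι₂}
    (h : ∀ φ : LocalSBFamily K ι₁,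
      B (finSBReindex K ε (finSumEquiv K ι₁ ι₂ (piProdSB K ι₁ φ ⊗ₜ f₂))) =
        finSBReindex K ε (finSumEquiv K ι₁ ι₂ (B₁ (piProdSB K ι₁ φ) ⊗ₜ f₂)))
    (f₁ : FinSB K ι₁) :
    B (finSBReindex K ε (finSumEquiv K ι₁ ι₂ (f₁ ⊗ₜ f₂))) = finSBReindex K ε (finSumEquiv K ι₁ ι₂ (B₁ f₁ ⊗ₜ f₂)) := by
  have key : B ∘ₗ (finSBReindex K ε).toLinearMap ∘ₗ (finSumEquiv K ι₁ ι₂).toLinearMap ∘ₗ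
        (TensorProduct.mk ℂ (FinSB K ι₁) (FinSB K ι₂)).flip f₂ =
      (finSBReindex K ε).toLinearMap ∘ₗ (finSumEquiv K ι₁ ι₂).toLinearMap ∘ₗ
        (TensorProduct.mk ℂ (FinSB K ι₁) (FinSB K ι₂)).flip f₂ ∘ₗ B₁ :=
    LinearMap.ext_on_range (span_range_piProdSB (K := K) (ι := ι₁)) fun φ => h φ
  exact LinearMap.congr_fun key f₁

variable {K} in
/-- **a pure tensor of non-zero factors is a non-zero adelic Schwartz–Bruhat function** (over the field `ℂ`: test
against a pair of linear forms; `piSchwartzBruhatEquiv` is injective). [cite: Weil1964, n° 29 (standard functions are sums of products of local ones), Chap. III n° 37–38 pp. 188–190] -/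
theorem piSchwartzBruhatEquiv_tmul_ne_zero {ι : Type} [Fintype ι] {a : 𝓢((ι → mixedSpace K), ℂ)} {f : FinSB K ι}
    (ha : a ≠ 0) (hf : f ≠ 0) : piSchwartzBruhatEquiv K ι (a ⊗ₜ f) ≠ 0 := by
  rw [(piSchwartzBruhatEquiv K ι).map_ne_zero_iff]
  obtain ⟨φ, hφ⟩ := Module.Projective.exists_dual_ne_zero ℂ ha
  obtain ⟨ψ, hψ⟩ := Module.Projective.exists_dual_ne_zero ℂ hf
  intro h
  have h' : TensorProduct.lift ((LinearMap.mul ℂ ℂ).compl₁₂ φ ψ) (a ⊗ₜ[ℂ] f) = φ a * ψ f := by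
    rw [TensorProduct.lift.tmul]
    rfl
  rw [h, map_zero] at h'
  exact mul_ne_zero hφ hψ h'.symm

end Reindex

variable (L : Type) [Field L] [NumberField L] [IsCMField L]

variable {N M n : ℕ} (e : Fin N × Fin M ≃ Fin n)
  (dV : Fin N → L) (hdV : ∀ i, IsCMField.complexConj L (dV i) = dV i) (hdV0 : ∀ i, dV i ≠ 0)
  (dW : Fin M → L) (hdW : ∀ i, IsCMField.complexConj L (dW i) = dW i) (hdW0 : ∀ i, dW i ≠ 0)

section Through

variable {sD : HA L e dV hdV dW hdW →* MpD L e dV hdV dW hdW}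

/-! ## §1 `ω ∘ u` through `undoubleIdx` -/

variable (sD) in
/-- **`ω(u(g))` through the index change**: `ω_{T ⊕ (−T)}(u(g)) Ψ = R_{e₂⁻¹} (ω_{T^𝔻}(sD (g ⊕ 1)) (R_{e₂} Ψ))`
(`u = relabel₁ ∘ reindex_{e₂⁻¹} ∘ sD ∘ (· ⊕ 1)`; `ω ∘ relabel = ω`, `ω(reindex p) = R_e ∘ ω(p) ∘ R_e⁻¹`), for any `sD`.
[cite: Kudla1994, §2 (doubled space, Siegel parabolic), Thm. 3.1] -/
theorem omega_uD_apply
    (g : UnitaryGroup.adelicPair (Fp L) L (IsCMField.complexConj L) N M (Matrix.diagonal dV) (Matrix.diagonal dW))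
    (Ψ : piSchwartzBruhat (Fp L) (Fin n ⊕ Fin n)) :
    adelicMpCont.omega (Fp L) (Fin n ⊕ Fin n) (gramS L e dV hdV dW hdW) (uD L e dV hdV dW hdW sD g) Ψ =
      piSBReindex (Fp L) (e₂ (n := n)).symm
        (adelicMpCont.omega (Fp L) (Fin (n + n)) (gramDA L e dV hdV dW hdW) (sD (inlG L e dV hdV dW hdW g))
          (piSBReindex (Fp L) (e₂ (n := n)) Ψ)) := by
  -- `u(g) = relabel₁ (reindex_{e₂⁻¹} (sD (g ⊕ 1)))` definitionally; `ω ∘ relabel = ω`, then `ω ∘ reindex` conjugates by `R`.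
  have h1 : adelicMpCont.omega (Fp L) (Fin n ⊕ Fin n) (gramS L e dV hdV dW hdW) (uD L e dV hdV dW hdW sD g) Ψ =
      adelicMpCont.omega (Fp L) (Fin n ⊕ Fin n)
        (Matrix.reindex (e₂ (n := n)).symm (e₂ (n := n)).symm (gramDA L e dV hdV dW hdW))
        (adelicMpContReindex (Fp L) (e₂ (n := n)).symm (gramDA L e dV hdV dW hdW) (sD (inlG L e dV hdV dW hdW g))) Ψ :=
    congrArg (fun T : Module.End ℂ (piSchwartzBruhat (Fp L) (Fin n ⊕ Fin n)) => T Ψ)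
      (adelicMpCont.omega_relabel (Fp L) (Fin n ⊕ Fin n) 1 (gramS_mul_one L e dV hdV dW hdW)
        (adelicMpContReindex (Fp L) (e₂ (n := n)).symm (gramDA L e dV hdV dW hdW) (sD (inlG L e dV hdV dW hdW g))))
  have h2 := adelicMpCont.omega_reindex_apply (Fp L) (e₂ (n := n)).symm (gramDA L e dV hdV dW hdW)
    (sD (inlG L e dV hdV dW hdW g)) Ψ
  exact h1.trans h2

/-! ## §3 `ω(u(g))` on pure tensors when `sD (g ⊕ 1)` acts by a finite operator -/

variable (sD) in
/-- **`ω(u(g))` on pure tensors, finite-operator case**: if `ω(sD (g ⊕ 1)) = 1 ⊗ B` then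
`ω(u(g))((a₁ ⊗ f₁) ⊠ (a₂ ⊗ f₂)) = R_{e₂⁻¹} (R_{e₂}^∞ (a₁ ⊠_∞ a₂) ⊗ B (R_{e₂}^f (f₁ ⊠_f f₂)))`.
[cite: Kudla1994, §2 (doubled space, Siegel parabolic), Thm. 3.1] -/
theorem omega_uD_tensorToSum_tmul
    (g : UnitaryGroup.adelicPair (Fp L) L (IsCMField.complexConj L) N M (Matrix.diagonal dV) (Matrix.diagonal dW))
    {B : FinSB (Fp L) (Fin (n + n)) →ₗ[ℂ] FinSB (Fp L) (Fin (n + n))}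
    (hB : (adelicMpCont.omega (Fp L) (Fin (n + n)) (gramDA L e dV hdV dW hdW) (sD (inlG L e dV hdV dW hdW g)) :
        piSchwartzBruhat (Fp L) (Fin (n + n)) →ₗ[ℂ] piSchwartzBruhat (Fp L) (Fin (n + n))) =
      adelicTensorEnd LinearMap.id B)
    (a₁ a₂ : 𝓢((Fin n → mixedSpace (Fp L)), ℂ)) (f₁ f₂ : FinSB (Fp L) (Fin n)) :
    adelicMpCont.omega (Fp L) (Fin n ⊕ Fin n) (gramS L e dV hdV dW hdW) (uD L e dV hdV dW hdW sD g)
        (tensorToSum (Fp L) (Fin n) (Fin n) (piSchwartzBruhatEquiv (Fp L) (Fin n) (a₁ ⊗ₜ f₁))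
          (piSchwartzBruhatEquiv (Fp L) (Fin n) (a₂ ⊗ₜ f₂))) =
      piSBReindex (Fp L) (e₂ (n := n)).symm (piSchwartzBruhatEquiv (Fp L) (Fin (n + n))
        (schwartzReindexCLM (Fp L) (e₂ (n := n)) (archBoxTensor a₁ a₂) ⊗ₜ
          B (finSBReindex (Fp L) (e₂ (n := n)) (finSumEquiv (Fp L) (Fin n) (Fin n) (f₁ ⊗ₜ f₂))))) := by
  have h1 := omega_uD_apply L e dV hdV dW hdW sD g
    (tensorToSum (Fp L) (Fin n) (Fin n) (piSchwartzBruhatEquiv (Fp L) (Fin n) (a₁ ⊗ₜ f₁))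
      (piSchwartzBruhatEquiv (Fp L) (Fin n) (a₂ ⊗ₜ f₂)))
  have h2 := piSBReindex_tensorToSum_tmul (Fp L) (e₂ (n := n)) a₁ f₁ a₂ f₂
  have h3 : adelicMpCont.omega (Fp L) (Fin (n + n)) (gramDA L e dV hdV dW hdW) (sD (inlG L e dV hdV dW hdW g))
      (piSchwartzBruhatEquiv (Fp L) (Fin (n + n))
        (schwartzReindexCLM (Fp L) (e₂ (n := n)) (archBoxTensor a₁ a₂) ⊗ₜ
          finSBReindex (Fp L) (e₂ (n := n)) (finSumEquiv (Fp L) (Fin n) (Fin n) (f₁ ⊗ₜ f₂)))) =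
      piSchwartzBruhatEquiv (Fp L) (Fin (n + n))
        (schwartzReindexCLM (Fp L) (e₂ (n := n)) (archBoxTensor a₁ a₂) ⊗ₜ
          B (finSBReindex (Fp L) (e₂ (n := n)) (finSumEquiv (Fp L) (Fin n) (Fin n) (f₁ ⊗ₜ f₂)))) :=
    (LinearMap.congr_fun hB _).trans ((adelicTensorEnd_apply_tmul _ _ _ _).trans (by rw [LinearMap.id_apply]))
  exact h1.trans (congrArg (piSBReindex (Fp L) (e₂ (n := n)).symm)
    ((congrArg (adelicMpCont.omega (Fp L) (Fin (n + n)) (gramDA L e dV hdV dW hdW) (sD (inlG L e dV hdV dW hdW g))) h2).trans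
      h3))

end Through

section FinHalf

open MeasureTheory

variable (χ : HeckeCharacter L) (𝔪 : ∀ v, PlaceMeasure L v) (𝓕 : FinLocalFamily L e dV hdV hdV0 dW hdW hdW0 χ 𝔪)

/-- the finite half acts on pure tensors by `1 ⊗ Ω^𝔻(h)` at the doubled data (the tree's `omega_finSplitting`, retyped at
`gramDA`/`finHalf`). [cite: GelbartRogawski1991, §3.1 Prop. 3.1.1 p. 455 L1–2] -/
theorem omega_finHalf_eq_adelicTensorEnd
    (h : UnitaryGroup.finAdelic (Fp L) L (IsCMField.complexConj L) (n + n) (hermD L e dV hdV dW hdW)) :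
    (adelicMpCont.omega (Fp L) (Fin (n + n)) (gramDA L e dV hdV dW hdW)
        (finHalf L e dV hdV hdV0 dW hdW hdW0 χ 𝔪 𝓕 h) :
        piSchwartzBruhat (Fp L) (Fin (n + n)) →ₗ[ℂ] piSchwartzBruhat (Fp L) (Fin (n + n))) =
      adelicTensorEnd LinearMap.id ((finSplittings L e dV hdV hdV0 dW hdW hdW0 χ 𝔪 𝓕).Omega h) :=
  (finSplittings L e dV hdV hdV0 dW hdW hdW0 χ 𝔪 𝓕).omega_finSplitting h

/-- **`ω(u(g))` on pure tensors when `sD (g ⊕ 1)` is the finite half at `h`**: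
`ω(u(g))((a₁ ⊗ f₁) ⊠ (a₂ ⊗ f₂)) = R_{e₂⁻¹} (R_{e₂}^∞ (a₁ ⊠_∞ a₂) ⊗ Ω^𝔻(h) (R_{e₂}^f (f₁ ⊠_f f₂)))`.
[cite: Kudla1994, §2 (doubled space, Siegel parabolic), Thm. 3.1] -/
theorem omega_uD_tensorToSum_tmul_of_eq_finHalf (sD : HA L e dV hdV dW hdW →* MpD L e dV hdV dW hdW)
    (g : UnitaryGroup.adelicPair (Fp L) L (IsCMField.complexConj L) N M (Matrix.diagonal dV) (Matrix.diagonal dW))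
    (h : UnitaryGroup.finAdelic (Fp L) L (IsCMField.complexConj L) (n + n) (hermD L e dV hdV dW hdW))
    (hfin : sD (inlG L e dV hdV dW hdW g) = finHalf L e dV hdV hdV0 dW hdW hdW0 χ 𝔪 𝓕 h)
    (a₁ a₂ : 𝓢((Fin n → mixedSpace (Fp L)), ℂ)) (f₁ f₂ : FinSB (Fp L) (Fin n)) :
    adelicMpCont.omega (Fp L) (Fin n ⊕ Fin n) (gramS L e dV hdV dW hdW) (uD L e dV hdV dW hdW sD g)
        (tensorToSum (Fp L) (Fin n) (Fin n) (piSchwartzBruhatEquiv (Fp L) (Fin n) (a₁ ⊗ₜ f₁))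
          (piSchwartzBruhatEquiv (Fp L) (Fin n) (a₂ ⊗ₜ f₂))) =
      piSBReindex (Fp L) (e₂ (n := n)).symm (piSchwartzBruhatEquiv (Fp L) (Fin (n + n))
        (schwartzReindexCLM (Fp L) (e₂ (n := n)) (archBoxTensor a₁ a₂) ⊗ₜ
          (finSplittings L e dV hdV hdV0 dW hdW hdW0 χ 𝔪 𝓕).Omega h
            (finSBReindex (Fp L) (e₂ (n := n)) (finSumEquiv (Fp L) (Fin n) (Fin n) (f₁ ⊗ₜ f₂))))) :=
  omega_uD_tensorToSum_tmul L e dV hdV dW hdW sD g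
    ((congrArg (fun q : MpD L e dV hdV dW hdW =>
        (adelicMpCont.omega (Fp L) (Fin (n + n)) (gramDA L e dV hdV dW hdW) q :
          piSchwartzBruhat (Fp L) (Fin (n + n)) →ₗ[ℂ] piSchwartzBruhat (Fp L) (Fin (n + n)))) hfin).trans
      (omega_finHalf_eq_adelicTensorEnd L e dV hdV hdV0 dW hdW hdW0 χ 𝔪 𝓕 h)) a₁ a₂ f₁ f₂

end FinHalf

section FoldBack

variable {sD : HA L e dV hdV dW hdW →* MpD L e dV hdV dW hdW}

/-! ## §4 Fold-back and read-back on the undoubled splitting -/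

variable (sD) in
/-- **fold-back**: if `ω(sD (g ⊕ 1)) = 1 ⊗ B` and `B (R_{e₂}^f (f₁ ⊠_f f₂)) = R_{e₂}^f (f₁′ ⊠_f f₂′)` then
`ω(u(g))((a₁ ⊗ f₁) ⊠ (a₂ ⊗ f₂)) = (a₁ ⊗ f₁′) ⊠ (a₂ ⊗ f₂′)` (the archimedean factor does not move).
[cite: Kudla1994, §2 (doubled space, Siegel parabolic), Thm. 3.1] -/
theorem omega_uD_tensorToSum_tmul_eq_tensorToSum
    (g : UnitaryGroup.adelicPair (Fp L) L (IsCMField.complexConj L) N M (Matrix.diagonal dV) (Matrix.diagonal dW))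
    {B : FinSB (Fp L) (Fin (n + n)) →ₗ[ℂ] FinSB (Fp L) (Fin (n + n))}
    (hB : (adelicMpCont.omega (Fp L) (Fin (n + n)) (gramDA L e dV hdV dW hdW) (sD (inlG L e dV hdV dW hdW g)) :
        piSchwartzBruhat (Fp L) (Fin (n + n)) →ₗ[ℂ] piSchwartzBruhat (Fp L) (Fin (n + n))) =
      adelicTensorEnd LinearMap.id B)
    (a₁ a₂ : 𝓢((Fin n → mixedSpace (Fp L)), ℂ)) {f₁ f₂ f₁' f₂' : FinSB (Fp L) (Fin n)}
    (hBf : B (finSBReindex (Fp L) (e₂ (n := n)) (finSumEquiv (Fp L) (Fin n) (Fin n) (f₁ ⊗ₜ f₂))) =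
      finSBReindex (Fp L) (e₂ (n := n)) (finSumEquiv (Fp L) (Fin n) (Fin n) (f₁' ⊗ₜ f₂'))) :
    adelicMpCont.omega (Fp L) (Fin n ⊕ Fin n) (gramS L e dV hdV dW hdW) (uD L e dV hdV dW hdW sD g)
        (tensorToSum (Fp L) (Fin n) (Fin n) (piSchwartzBruhatEquiv (Fp L) (Fin n) (a₁ ⊗ₜ f₁))
          (piSchwartzBruhatEquiv (Fp L) (Fin n) (a₂ ⊗ₜ f₂))) =
      tensorToSum (Fp L) (Fin n) (Fin n) (piSchwartzBruhatEquiv (Fp L) (Fin n) (a₁ ⊗ₜ f₁'))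
        (piSchwartzBruhatEquiv (Fp L) (Fin n) (a₂ ⊗ₜ f₂')) := by
  rw [omega_uD_tensorToSum_tmul L e dV hdV dW hdW sD g hB, hBf, piSBReindex_symm_tmul_eq_tensorToSum]

/-- **read-back on `s(g) = undouble sD g`**: under the hypotheses of the fold-back with `f₂′ = f₂` and a non-zero second
factor `a₂ ⊗ f₂`, `ω(s(g))(a₁ ⊗ f₁) = a₁ ⊗ f₁′` (product formula `omega_uD_tensorToSum` + `⊠ Φ₂`-cancellation).
[cite: Kudla1994, §2 (doubled space, Siegel parabolic), Thm. 3.1] -/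
theorem omega_undouble_tmul (hproj : ∀ h, projD L e dV hdV dW hdW (sD h) = toSpD L e dV hdV dW hdW h)
    (g : UnitaryGroup.adelicPair (Fp L) L (IsCMField.complexConj L) N M (Matrix.diagonal dV) (Matrix.diagonal dW))
    {B : FinSB (Fp L) (Fin (n + n)) →ₗ[ℂ] FinSB (Fp L) (Fin (n + n))}
    (hB : (adelicMpCont.omega (Fp L) (Fin (n + n)) (gramDA L e dV hdV dW hdW) (sD (inlG L e dV hdV dW hdW g)) :
        piSchwartzBruhat (Fp L) (Fin (n + n)) →ₗ[ℂ] piSchwartzBruhat (Fp L) (Fin (n + n))) =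
      adelicTensorEnd LinearMap.id B)
    (a₁ a₂ : 𝓢((Fin n → mixedSpace (Fp L)), ℂ)) {f₁ f₁' f₂ : FinSB (Fp L) (Fin n)}
    (hBf : B (finSBReindex (Fp L) (e₂ (n := n)) (finSumEquiv (Fp L) (Fin n) (Fin n) (f₁ ⊗ₜ f₂))) =
      finSBReindex (Fp L) (e₂ (n := n)) (finSumEquiv (Fp L) (Fin n) (Fin n) (f₁' ⊗ₜ f₂)))
    (hΦ₂ : piSchwartzBruhatEquiv (Fp L) (Fin n) (a₂ ⊗ₜ f₂) ≠ 0) :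
    adelicMpCont.omega (Fp L) (Fin n) (gramA L e dV hdV dW hdW) (undouble L e dV hdV hdV0 dW hdW hdW0 hproj g)
        (piSchwartzBruhatEquiv (Fp L) (Fin n) (a₁ ⊗ₜ f₁)) =
      piSchwartzBruhatEquiv (Fp L) (Fin n) (a₁ ⊗ₜ f₁') :=
  tensorToSum_left_cancel hΦ₂
    ((omega_uD_tensorToSum L e dV hdV hdV0 dW hdW hdW0 hproj g (piSchwartzBruhatEquiv (Fp L) (Fin n) (a₁ ⊗ₜ f₁))
      (piSchwartzBruhatEquiv (Fp L) (Fin n) (a₂ ⊗ₜ f₂))).symm.trans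
      (omega_uD_tensorToSum_tmul_eq_tensorToSum L e dV hdV dW hdW sD g hB a₁ a₂ hBf))

/-- **operator form of the read-back**: if `ω(sD (g ⊕ 1)) = 1 ⊗ B` and `B (R_{e₂}^f (f₁ ⊠_f f₂)) = R_{e₂}^f (B₁ f₁ ⊠_f f₂)`
for every `f₁` and one `f₂` with `a₂ ⊗ f₂ ≠ 0` for some `a₂`, then `ω(s(g)) = 1 ⊗ B₁` (pure tensors span, `linearMap_ext_tensor`).
[cite: Kudla1994, §2 (doubled space, Siegel parabolic), Thm. 3.1] -/
theorem omega_undouble_eq_adelicTensorEnd (hproj : ∀ h, projD L e dV hdV dW hdW (sD h) = toSpD L e dV hdV dW hdW h)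
    (g : UnitaryGroup.adelicPair (Fp L) L (IsCMField.complexConj L) N M (Matrix.diagonal dV) (Matrix.diagonal dW))
    {B : FinSB (Fp L) (Fin (n + n)) →ₗ[ℂ] FinSB (Fp L) (Fin (n + n))}
    (hB : (adelicMpCont.omega (Fp L) (Fin (n + n)) (gramDA L e dV hdV dW hdW) (sD (inlG L e dV hdV dW hdW g)) :
        piSchwartzBruhat (Fp L) (Fin (n + n)) →ₗ[ℂ] piSchwartzBruhat (Fp L) (Fin (n + n))) =
      adelicTensorEnd LinearMap.id B)
    {B₁ : FinSB (Fp L) (Fin n) →ₗ[ℂ] FinSB (Fp L) (Fin n)} {a₂ : 𝓢((Fin n → mixedSpace (Fp L)), ℂ)}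
    {f₂ : FinSB (Fp L) (Fin n)} (hΦ₂ : piSchwartzBruhatEquiv (Fp L) (Fin n) (a₂ ⊗ₜ f₂) ≠ 0)
    (hBf : ∀ f₁ : FinSB (Fp L) (Fin n),
      B (finSBReindex (Fp L) (e₂ (n := n)) (finSumEquiv (Fp L) (Fin n) (Fin n) (f₁ ⊗ₜ f₂))) =
        finSBReindex (Fp L) (e₂ (n := n)) (finSumEquiv (Fp L) (Fin n) (Fin n) (B₁ f₁ ⊗ₜ f₂))) :
    (adelicMpCont.omega (Fp L) (Fin n) (gramA L e dV hdV dW hdW) (undouble L e dV hdV hdV0 dW hdW hdW0 hproj g) :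
        piSchwartzBruhat (Fp L) (Fin n) →ₗ[ℂ] piSchwartzBruhat (Fp L) (Fin n)) =
      adelicTensorEnd LinearMap.id B₁ :=
  linearMap_ext_tensor fun a₁ f₁ =>
    (omega_undouble_tmul L e dV hdV hdV0 dW hdW hdW0 hproj g hB a₁ a₂ (hBf f₁) hΦ₂).trans
      ((adelicTensorEnd_apply_tmul _ _ a₁ f₁).trans (by rw [LinearMap.id_apply])).symm

/-! ## §5 Identification of `s(g)`: `(π, ω)` are jointly injective on `Mp(𝕎)ᶜᵒⁿᵗ` -/

/-- **an element of `Mp(𝕎)ᶜᵒⁿᵗ` over `ι(g)` with the same Weil operator as `s(g)` IS `s(g)`** (pairs: `π` and `ω` are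
jointly injective; the `Fin n`/`T ⊗ 1` twin of `eq_of_proj_eq_of_omega_eq`).
[cite: Kudla1994, §2 (doubled space, Siegel parabolic), Thm. 3.1] -/
theorem undouble_eq_of_proj_eq_of_omega_eq (hproj : ∀ h, projD L e dV hdV dW hdW (sD h) = toSpD L e dV hdV dW hdW h)
    (g : UnitaryGroup.adelicPair (Fp L) L (IsCMField.complexConj L) N M (Matrix.diagonal dV) (Matrix.diagonal dW))
    (q : adelicMpCont (Fp L) (Fin n) (gramA L e dV hdV dW hdW))
    (hq : adelicMpCont.proj (Fp L) (Fin n) (gramA L e dV hdV dW hdW) q = (D L e dV hdV hdV0 dW hdW hdW0).toSp g)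
    (hω : ∀ Φ : piSchwartzBruhat (Fp L) (Fin n),
      adelicMpCont.omega (Fp L) (Fin n) (gramA L e dV hdV dW hdW) (undouble L e dV hdV hdV0 dW hdW hdW0 hproj g) Φ =
        adelicMpCont.omega (Fp L) (Fin n) (gramA L e dV hdV dW hdW) q Φ) :
    undouble L e dV hdV hdV0 dW hdW hdW0 hproj g = q :=
  Subtype.ext (Subtype.ext (Prod.ext ((proj_undouble L e dV hdV hdV0 dW hdW hdW0 hproj g).trans hq.symm)
    (LinearEquiv.ext fun Φ => hω Φ)))

/-- **identification of `s(g)` by a finite operator**: if `ω(sD (g ⊕ 1)) = 1 ⊗ B`, `B (R_{e₂}^f (f₁ ⊠_f f₂)) = R_{e₂}^f (B₁ f₁ ⊠_f f₂)`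
for all `f₁` (one `f₂`, some `a₂ ⊗ f₂ ≠ 0`), and `q ∈ Mp(𝕎)ᶜᵒⁿᵗ` lies over `ι(g)` with `ω(q) = 1 ⊗ B₁`, then `s(g) = q`.
[cite: Kudla1994, §2 (doubled space, Siegel parabolic), Thm. 3.1] -/
theorem undouble_eq_of_omega_eq_adelicTensorEnd
    (hproj : ∀ h, projD L e dV hdV dW hdW (sD h) = toSpD L e dV hdV dW hdW h)
    (g : UnitaryGroup.adelicPair (Fp L) L (IsCMField.complexConj L) N M (Matrix.diagonal dV) (Matrix.diagonal dW))
    {B : FinSB (Fp L) (Fin (n + n)) →ₗ[ℂ] FinSB (Fp L) (Fin (n + n))}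
    (hB : (adelicMpCont.omega (Fp L) (Fin (n + n)) (gramDA L e dV hdV dW hdW) (sD (inlG L e dV hdV dW hdW g)) :
        piSchwartzBruhat (Fp L) (Fin (n + n)) →ₗ[ℂ] piSchwartzBruhat (Fp L) (Fin (n + n))) =
      adelicTensorEnd LinearMap.id B)
    {B₁ : FinSB (Fp L) (Fin n) →ₗ[ℂ] FinSB (Fp L) (Fin n)} {a₂ : 𝓢((Fin n → mixedSpace (Fp L)), ℂ)}
    {f₂ : FinSB (Fp L) (Fin n)} (hΦ₂ : piSchwartzBruhatEquiv (Fp L) (Fin n) (a₂ ⊗ₜ f₂) ≠ 0)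
    (hBf : ∀ f₁ : FinSB (Fp L) (Fin n),
      B (finSBReindex (Fp L) (e₂ (n := n)) (finSumEquiv (Fp L) (Fin n) (Fin n) (f₁ ⊗ₜ f₂))) =
        finSBReindex (Fp L) (e₂ (n := n)) (finSumEquiv (Fp L) (Fin n) (Fin n) (B₁ f₁ ⊗ₜ f₂)))
    (q : adelicMpCont (Fp L) (Fin n) (gramA L e dV hdV dW hdW))
    (hq : adelicMpCont.proj (Fp L) (Fin n) (gramA L e dV hdV dW hdW) q = (D L e dV hdV hdV0 dW hdW hdW0).toSp g)
    (hωq : (adelicMpCont.omega (Fp L) (Fin n) (gramA L e dV hdV dW hdW) q :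
        piSchwartzBruhat (Fp L) (Fin n) →ₗ[ℂ] piSchwartzBruhat (Fp L) (Fin n)) = adelicTensorEnd LinearMap.id B₁) :
    undouble L e dV hdV hdV0 dW hdW hdW0 hproj g = q :=
  undouble_eq_of_proj_eq_of_omega_eq L e dV hdV hdV0 dW hdW hdW0 hproj g q hq fun Φ =>
    LinearMap.congr_fun ((omega_undouble_eq_adelicTensorEnd L e dV hdV hdV0 dW hdW hdW0 hproj g hB hΦ₂ hBf).trans
      hωq.symm) Φ

/-- **identification of `s(g)`, box-vector form**: as `undouble_eq_of_omega_eq_adelicTensorEnd`, with the finite identity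
`B (R_{e₂}^f (f₁ ⊠_f f₂)) = R_{e₂}^f (B₁ f₁ ⊠_f f₂)` required only on the place-pure tensors `f₁ = ⊗_v φ_v`
(`finBox_eq_of_piProdSB`). [cite: Kudla1994, §2 (doubled space, Siegel parabolic), Thm. 3.1] -/
theorem undouble_eq_of_omega_eq_adelicTensorEnd_of_piProdSB
    (hproj : ∀ h, projD L e dV hdV dW hdW (sD h) = toSpD L e dV hdV dW hdW h)
    (g : UnitaryGroup.adelicPair (Fp L) L (IsCMField.complexConj L) N M (Matrix.diagonal dV) (Matrix.diagonal dW))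
    {B : FinSB (Fp L) (Fin (n + n)) →ₗ[ℂ] FinSB (Fp L) (Fin (n + n))}
    (hB : (adelicMpCont.omega (Fp L) (Fin (n + n)) (gramDA L e dV hdV dW hdW) (sD (inlG L e dV hdV dW hdW g)) :
        piSchwartzBruhat (Fp L) (Fin (n + n)) →ₗ[ℂ] piSchwartzBruhat (Fp L) (Fin (n + n))) =
      adelicTensorEnd LinearMap.id B)
    {B₁ : FinSB (Fp L) (Fin n) →ₗ[ℂ] FinSB (Fp L) (Fin n)} {a₂ : 𝓢((Fin n → mixedSpace (Fp L)), ℂ)}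
    {f₂ : FinSB (Fp L) (Fin n)} (hΦ₂ : piSchwartzBruhatEquiv (Fp L) (Fin n) (a₂ ⊗ₜ f₂) ≠ 0)
    (hBf : ∀ φ : LocalSBFamily (Fp L) (Fin n),
      B (finSBReindex (Fp L) (e₂ (n := n)) (finSumEquiv (Fp L) (Fin n) (Fin n) (piProdSB (Fp L) (Fin n) φ ⊗ₜ f₂))) =
        finSBReindex (Fp L) (e₂ (n := n))
          (finSumEquiv (Fp L) (Fin n) (Fin n) (B₁ (piProdSB (Fp L) (Fin n) φ) ⊗ₜ f₂)))
    (q : adelicMpCont (Fp L) (Fin n) (gramA L e dV hdV dW hdW))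
    (hq : adelicMpCont.proj (Fp L) (Fin n) (gramA L e dV hdV dW hdW) q = (D L e dV hdV hdV0 dW hdW hdW0).toSp g)
    (hωq : (adelicMpCont.omega (Fp L) (Fin n) (gramA L e dV hdV dW hdW) q :
        piSchwartzBruhat (Fp L) (Fin n) →ₗ[ℂ] piSchwartzBruhat (Fp L) (Fin n)) = adelicTensorEnd LinearMap.id B₁) :
    undouble L e dV hdV hdV0 dW hdW hdW0 hproj g = q :=
  undouble_eq_of_omega_eq_adelicTensorEnd L e dV hdV hdV0 dW hdW hdW0 hproj g hB hΦ₂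
    (finBox_eq_of_piProdSB (e₂ (n := n)) hBf) q hq hωq

end FoldBack

/-! ### Build-lane note (ops-buildfix G11b-3 recipe, LEDGER B13-1/B13-3): the public theorems are tagged
`[implicit_reducible]` only to keep them out of the `.olean` exporter's premise index (see the note in
`DoubledWeilRepresentationUndoubling`); no statement or proof is changed. -/
set_option allowUnsafeReducibility true in
attribute [implicit_reducible]
  piSBReindex_tensorToSum_tmul piSBReindex_symm_tmul_eq_tensorToSum tensorToSum_left_cancel
  finBox_eq_of_piProdSB piSchwartzBruhatEquiv_tmul_ne_zero
  omega_uD_apply omega_uD_tensorToSum_tmul omega_finHalf_eq_adelicTensorEnd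
  omega_uD_tensorToSum_tmul_of_eq_finHalf omega_uD_tensorToSum_tmul_eq_tensorToSum omega_undouble_tmul
  omega_undouble_eq_adelicTensorEnd undouble_eq_of_proj_eq_of_omega_eq undouble_eq_of_omega_eq_adelicTensorEnd
  undouble_eq_of_omega_eq_adelicTensorEnd_of_piProdSB

end Literature.NumberTheory.GelbartRogawski1991.GRConstruction
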